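import Literature.Geometry.DiscreteGeometry.KissingArccosBrackets
import HarnessLib

/-!
# The numeric tables and slot brackets of the kissing LP checker

Topic `Literature/Geometry/DiscreteGeometry`; provefact brick for `Hales2012_contactGraphTame`
(`TameContactGraphs.lean`).  COMPUTABLE DEFINITIONS ONLY (nothing is asserted): the certified
rational/integer stand-ins for the real quantities that enter the linear programs over the
fan-refined hull triangulation of a twelve-point kissing configuration
(`KissingFanTriangleSets.lean`, `IsoscelesContactTriangleAngles.lean`) — used by the checker
`KissingLPCheck.lean`, proved to ENCLOSE the reals in `KissingLPNumerics.lean` /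
`KissingLPSlots.lean`:

* Part A — angles in units of `δ = 1/512` through the ladder of `KissingArccosBrackets.lean`
  with the cosine tables `cosLoTab`/`cosHiTab` (the polynomial brackets rounded outward to
  `2⁻⁴⁰`; beyond `13/5` the value at `13/5`, `cos` being decreasing on `[0, π]`):
  `ladDown`, `ladUp`, `ladSqrtDown`, `ladSqrtUp`; the cosine GRID `XG`
  (`κ₀ = 1031/5000, 6/32, 5/32, …, −16/32`, cell `j = [XG[j+1], XG[j]]`); square roots by
  `Nat.sqrt` (`sqrtLo`, `sqrtHi`); the tables `SQLO/SQHI` (`√(1 − x²)`), `APEXLO/HI`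
  (isosceles apex `arccos ((4x−1)/3)`), `BASELO/HI` (isosceles base `arccos √((1−x)/(3(1+x)))`),
  `A3LO/HI` (`α₃`), `SCLO/SCHI` (`√3/2`) at the grid points;
* Part B — side descriptors `Side` (a contact, or a long side with cosine in a cell range),
  the law-of-cosines bracket `generalBounds`, the slot bracket `slotBounds` of the angle of a
  triangle at a vertex, the static brackets `staticBounds`/`staticTab`/`staticOf`/`minStatic`
  (by label type, the single long side of an isosceles contact triangle capped at `x > −1/3`),
  and the monotone trimming of cell ranges `trimApex`, `trimBase`.

## References
* T. C. Hales, arXiv:1209.6043 (2012), Lemma 7, proof of Lemma 9. [`Hales2012`]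
* R. E. Moore, *Interval Analysis* (1966), Theorem 3.1, §4.4. [`Moore1966`]
-/

namespace Literature.Geometry.DiscreteGeometry

namespace KissingLP

/-! ### Part A. Numeric tables -/

/-- The angle unit `δ = 1/512` (radians). [folklore] -/
def δ : ℚ := 1 / 512
/-- Ladder length: `1609 δ ≥ 3.1416`. [folklore] -/
def NLAD : ℕ := 1609
/-- `2π` brackets in units of `δ`: `3216 δ ≤ 2π ≤ 3217 δ`. [folklore] -/
def TWOPI_LO : ℕ := 3216
/-- See `TWOPI_LO`. [folklore] -/
def TWOPI_HI : ℕ := 3217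

/-- Round down to the dyadic grid `2⁻⁴⁰ ℤ`. [folklore] -/
def rdown (q : ℚ) : ℚ := (⌊q * 2 ^ 40⌋ : ℚ) / 2 ^ 40
/-- Round up to the dyadic grid `2⁻⁴⁰ ℤ`. [folklore] -/
def rup (q : ℚ) : ℚ := (⌈q * 2 ^ 40⌉ : ℚ) / 2 ^ 40

/-- `cosLoTab[k] ≤ cos (k δ)` (`−1` beyond `13/5`). [folklore] -/
def cosLoTab : Array ℚ :=
  (Array.range (NLAD + 1)).map fun (k : ℕ) =>
    if (k : ℚ) * δ ≤ 13 / 5 then rdown (cosLoQ ((k : ℚ) * δ)) else -1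
/-- `cos (k δ) ≤ cosHiTab[k]` for `k δ ≤ π` (beyond `13/5` the value at `13/5` is used:
`cos` is decreasing on `[0, π]`). [folklore] -/
def cosHiTab : Array ℚ :=
  (Array.range (NLAD + 1)).map fun (k : ℕ) => rup (cosHiQ (min ((k : ℚ) * δ) (13 / 5)))

/-- Table form of `leArccosB`: certifies `k δ ≤ arccos q`. [folklore] -/
def leArccosT (k : ℕ) (q : ℚ) : Bool :=
  decide (k ≤ NLAD) && decide ((k : ℚ) * δ ≤ 13 / 5) && decide (q ≤ cosLoTab.getD k (-2))
/-- `1608 δ < π`: the largest ladder index below `π`. [folklore] -/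
def KPI : ℕ := 1608

/-- Table form of `arccosLeB`: certifies `arccos q ≤ k δ` (`k ≤ KPI` and `cosHiTab[k] ≤ q`, or
`k δ ≥ 3.1416`). [folklore] -/
def arccosLeT (q : ℚ) (k : ℕ) : Bool :=
  (decide (k ≤ KPI) && decide (cosHiTab.getD k 2 ≤ q)) || decide ((3.1416 : ℚ) ≤ (k : ℚ) * δ)
/-- Table form of `leArccosSqrtB`: certifies `k δ ≤ arccos (√r)`. [folklore] -/
def leArccosSqrtT (k : ℕ) (r : ℚ) : Bool :=
  decide (k ≤ NLAD) && decide ((k : ℚ) * δ ≤ 13 / 5) && decide (0 ≤ cosLoTab.getD k (-2)) &&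
    decide (r ≤ cosLoTab.getD k (-2) ^ 2)
/-- Table form of `arccosSqrtLeB`: certifies `arccos (√r) ≤ k δ`. [folklore] -/
def arccosSqrtLeT (r : ℚ) (k : ℕ) : Bool :=
  (decide (k ≤ KPI) &&
    (decide (cosHiTab.getD k 2 ≤ 0) || (decide (0 ≤ r) && decide (cosHiTab.getD k 2 ^ 2 ≤ r)))) ||
    decide ((3.1416 : ℚ) ≤ (k : ℚ) * δ)

/-- A `k ≤ NLAD` with `k δ ≤ arccos q` certified (`0` if the search fails). [folklore] -/
def ladDown (q : ℚ) : ℕ :=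
  let k := bsearchMax (fun k => leArccosT k q) (NLAD + 1) 0 (NLAD + 1)
  if leArccosT k q then k else 0
/-- A `k ≤ NLAD` with `arccos q ≤ k δ` certified (`NLAD` if the search fails). [folklore] -/
def ladUp (q : ℚ) : ℕ :=
  let k := bsearchMin (fun k => arccosLeT q k) (NLAD + 1) 0 NLAD
  if arccosLeT q k then k else NLAD
/-- A `k` with `k δ ≤ arccos (√r)` certified. [folklore] -/
def ladSqrtDown (r : ℚ) : ℕ :=
  let k := bsearchMax (fun k => leArccosSqrtT k r) (NLAD + 1) 0 (NLAD + 1)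
  if leArccosSqrtT k r then k else 0
/-- A `k` with `arccos (√r) ≤ k δ` certified. [folklore] -/
def ladSqrtUp (r : ℚ) : ℕ :=
  let k := bsearchMin (fun k => arccosSqrtLeT r k) (NLAD + 1) 0 NLAD
  if arccosSqrtLeT r k then k else NLAD

/-- Hales's `κ₀ = 1031/5000`, the cosine of the shortest long side. [cite: Hales2012, Definition 1] -/
def κ0 : ℚ := 1031 / 5000
/-- The cosine grid, decreasing: `κ₀, 6/32, 5/32, …, −16/32`; cell `j` is `[XG[j+1], XG[j]]`.
[folklore] -/
def XG : Array ℚ := #[κ0] ++ ((Array.range 23).map fun (i : ℕ) => ((6 : ℚ) - i) / 32)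
/-- Number of cells. [folklore] -/
def K : ℕ := 23
/-- Grid value with default. [folklore] -/
def xg (j : ℕ) : ℚ := XG.getD j (-1 / 2)

/-- Square-root brackets: `(sqrtLo y)² ≤ y ≤ (sqrtHi y)²` for `y ≥ 0` (denominator `2³⁰`).
[folklore] -/
def sqrtLo (y : ℚ) : ℚ := (Nat.sqrt ⌊y * 2 ^ 60⌋.toNat : ℚ) / 2 ^ 30
/-- See `sqrtLo`. [folklore] -/
def sqrtHi (y : ℚ) : ℚ := ((Nat.sqrt ⌊y * 2 ^ 60⌋.toNat + 1 : ℕ) : ℚ) / 2 ^ 30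

/-- `√(1 − x²)` brackets at the grid points. [folklore] -/
def SQLO : Array ℚ := XG.map fun x => sqrtLo (1 - x ^ 2)
/-- See `SQLO`. [folklore] -/
def SQHI : Array ℚ := XG.map fun x => sqrtHi (1 - x ^ 2)
/-- Isosceles apex `arccos ((4x−1)/3)` brackets at the grid points (units of `δ`). [folklore] -/
def APEXLO : Array ℕ := XG.map fun x => ladDown ((4 * x - 1) / 3)
/-- See `APEXLO`. [folklore] -/
def APEXHI : Array ℕ := XG.map fun x => ladUp ((4 * x - 1) / 3)
/-- Isosceles base `arccos √((1−x)/(3(1+x)))` brackets at the grid points. [folklore] -/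
def BASELO : Array ℕ := XG.map fun x => ladSqrtDown ((1 - x) / (3 * (1 + x)))
/-- See `BASELO`. [folklore] -/
def BASEHI : Array ℕ := XG.map fun x => ladSqrtUp ((1 - x) / (3 * (1 + x)))
/-- `α₃ = arccos (1/3)` brackets. [folklore] -/
def A3LO : ℕ := ladDown (1 / 3)
/-- See `A3LO`. [folklore] -/
def A3HI : ℕ := ladUp (1 / 3)
/-- `√3/2 = √(1 − (1/2)²)` brackets (the contact sine). [folklore] -/
def SCLO : ℚ := sqrtLo (3 / 4)
/-- See `SCLO`. [folklore] -/
def SCHI : ℚ := sqrtHi (3 / 4)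

/-! ### Part B. Slot bounds -/

/-- A side of a triangle as the checker sees it: a contact, or a long side whose cosine lies in
the cells `jlo … jhi` of the grid. [folklore] -/
inductive Side
  | C : Side
  | R : ℕ → ℕ → Side
  deriving DecidableEq, Repr, Inhabited

/-- The full cell range `[−1/2, κ₀]`. [folklore] -/
def Side.full : Side := Side.R 0 (K - 1)

/-- Cosine interval of a side. [folklore] -/
def Side.xlo : Side → ℚ
  | .C => 1 / 2
  | .R _ jhi => xg (jhi + 1)
/-- See `Side.xlo`. [folklore] -/
def Side.xhi : Side → ℚ
  | .C => 1 / 2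
  | .R jlo _ => xg jlo
/-- Sine (`√(1 − x²)`) interval of a side. [folklore] -/
def Side.slo : Side → ℚ
  | .C => SCLO
  | .R jlo jhi =>
    if 0 ≤ xg (jhi + 1) then SQLO.getD jlo 0
    else if xg jlo ≤ 0 then SQLO.getD (jhi + 1) 0
    else min (SQLO.getD (jhi + 1) 0) (SQLO.getD jlo 0)
/-- See `Side.slo`. [folklore] -/
def Side.shi : Side → ℚ
  | .C => SCHI
  | .R jlo jhi =>
    if 0 ≤ xg (jhi + 1) then SQHI.getD (jhi + 1) 1
    else if xg jlo ≤ 0 then SQHI.getD jlo 1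
    else 1

/-- The law-of-cosines bracket of the angle opposite the side `a` between the sides `b`, `c`
(units of `δ`): the quotient `(x_a − x_b x_c)/(s_b s_c)` over the box, then the ladder.
[folklore] -/
def generalBounds (a b c : Side) : ℕ × ℕ :=
  let plo := min (min (b.xlo * c.xlo) (b.xlo * c.xhi)) (min (b.xhi * c.xlo) (b.xhi * c.xhi))
  let phi := max (max (b.xlo * c.xlo) (b.xlo * c.xhi)) (max (b.xhi * c.xlo) (b.xhi * c.xhi))
  let nlo := a.xlo - phi
  let nhi := a.xhi - plo
  let dlo := b.slo * c.slo
  let dhi := b.shi * c.shi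
  if dlo ≤ 0 then (0, NLAD)
  else
    let qlo := min (min (nlo / dlo) (nlo / dhi)) (min (nhi / dlo) (nhi / dhi))
    let qhi := max (max (nlo / dlo) (nlo / dhi)) (max (nhi / dlo) (nhi / dhi))
    (ladDown qhi, ladUp qlo)

/-- **The angle bracket of a slot** (opposite side `a`, sides `b`, `c` at the vertex), in units
of `δ`: equilateral, isosceles apex, isosceles base, or general. [folklore] -/
def slotBounds (a b c : Side) : ℕ × ℕ :=
  match a, b, c with
  | .C, .C, .C => (A3LO, A3HI)
  | .R jlo jhi, .C, .C => (APEXLO.getD jlo 0, APEXHI.getD (jhi + 1) NLAD)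
  | .C, .R jlo jhi, .C => (BASELO.getD (jhi + 1) 0, BASEHI.getD jlo NLAD)
  | .C, .C, .R jlo jhi => (BASELO.getD (jhi + 1) 0, BASEHI.getD jlo NLAD)
  | a, b, c => generalBounds a b c

/-- The cell range `x > −1/3` (cells `0 … 17`, since `XG[18] = −11/32 < −1/3`): the base of
an isosceles contact fan triangle has cosine `> −1/3`. [folklore] -/
def Side.capped : Side := Side.R 0 17

/-- Static bracket by label type only: full ranges, except that the single long side of an
isosceles contact triangle gets the capped range. [folklore] -/
def staticBounds (la lb lc : Bool) : ℕ × ℕ :=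
  let iso : Bool := (la && !lb && !lc) || (!la && lb && !lc) || (!la && !lb && lc)
  let rng : Side := if iso then Side.capped else Side.full
  slotBounds (if la then rng else .C) (if lb then rng else .C) (if lc then rng else .C)

/-- The eight static brackets, tabulated (index `4·la + 2·lb + lc`). [folklore] -/
def staticTab : Array (ℕ × ℕ) :=
  #[staticBounds false false false, staticBounds false false true,
    staticBounds false true false, staticBounds false true true,
    staticBounds true false false, staticBounds true false true,
    staticBounds true true false, staticBounds true true true]

/-- Table lookup of the static bracket. [folklore] -/
def staticOf (la lb lc : Bool) : ℕ × ℕ :=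
  staticTab.getD ((if la then 4 else 0) + (if lb then 2 else 0) + (if lc then 1 else 0)) (0, NLAD)

/-- The smallest static lower bound of any slot (a valid lower bound for every angle).
[folklore] -/
def minStatic : ℕ := (staticTab.map Prod.fst).foldl min NLAD

/-- Keep the cells `j ∈ [jlo, jhi]` of an apex range whose apex bracket
`[APEXLO[j], APEXHI[j+1]]` meets the window `[wlo, whi]`, trimming from both ends (`fuel`-bounded).
[folklore] -/
def trimApex (wlo whi : ℕ) : ℕ → ℕ → ℕ → Option (ℕ × ℕ)
  | 0, jlo, jhi => if jlo ≤ jhi then some (jlo, jhi) else none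
  | fuel + 1, jlo, jhi =>
    if jhi < jlo then none
    else if APEXHI.getD (jlo + 1) NLAD < wlo ∨ whi < APEXLO.getD jlo 0 then
      trimApex wlo whi fuel (jlo + 1) jhi
    else if APEXHI.getD (jhi + 1) NLAD < wlo ∨ whi < APEXLO.getD jhi 0 then
      trimApex wlo whi fuel jlo (jhi - 1)
    else some (jlo, jhi)

/-- The same for a base range: cell `j` has base bracket `[BASELO[j+1], BASEHI[j]]`. [folklore] -/
def trimBase (wlo whi : ℕ) : ℕ → ℕ → ℕ → Option (ℕ × ℕ)
  | 0, jlo, jhi => if jlo ≤ jhi then some (jlo, jhi) else none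
  | fuel + 1, jlo, jhi =>
    if jhi < jlo then none
    else if BASEHI.getD jlo NLAD < wlo ∨ whi < BASELO.getD (jlo + 1) 0 then
      trimBase wlo whi fuel (jlo + 1) jhi
    else if BASEHI.getD jhi NLAD < wlo ∨ whi < BASELO.getD (jhi + 1) 0 then
      trimBase wlo whi fuel jlo (jhi - 1)
    else some (jlo, jhi)

end KissingLP

end Literature.Geometry.DiscreteGeometry
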